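import Summits.QuantumFields.BalabanUV.T4Continuum.Support.B13KPStepTermWindow

/-!
# NE5 ∕ U3, route P2 — THE END IN THE TERM DATA's LETTERS: the majorant of record `m := Σ_ℓ G_ℓ` (so `hsum` is an identity and L03
# reads ONE (2.38)-shaped inequality on the summed per-term majorants), `ReadLip` BY CONSTRUCTION in the B13 format of the step's own
# weights, and route P2's END on the holder's functionals of record displaying only per-term printed-KIND data, W1∕W3∕W4 and numerics

Cell `pub-balaban`, unit `b2b-balaban-t4-ne5-p2` (T⁴ fan-out NE5 ∕ node U3, PROVER seat P2 «polymer-activity Lipschitz ∕ Kotecký–Preiss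
route», lineage gen 19; part 3 of `B13KPStepTermModel` ∕ `B13KPStepTermWindow`).  Summits-side new work under the LEAN PLACEMENT RULE (cell
bookkeeping over the swarm's objects of record; NOT a Literature module; nothing of the manuscripts under audit is asserted).  HONEST FRAMING:
rung (B)+1 of the FINITE-VOLUME T⁴ continuum programme — NOT infinite volume, NOT a mass gap, NOT the Clay problem, **NOT A PROOF OF NE5** (spine
0∕9).  HONEST DEPENDENCY (cell line, verbatim): continuum YM on T⁴ ⇐ BetaPertH ∧ nine spine estimates (0/9 proved); BetaPertH ⇐ (D1) ∧ (D4) ∧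
CAP+tail; G-an2-4 gates asym, D1 and NE2/3/4.

WHAT.  For term-format slots `𝔖 : TermSlots …` (leaf-08) and ONE family of term constants `𝔡 Z ℓ`:
* §1 **`termMajorant 𝔖 𝔡 Λop Λhist ρ₀`** — the majorant OF RECORD `m g U Z := Σ_{ℓ ∈ innerLabels (scale Z) Z} G_ℓ`, `G_ℓ = size + ampOp∕Λop +
  ampHist∕Λhist` of the term `(Z, ℓ)` (K6's per-term majorant; print's resummation (2.26) → (2.38) is such a sum); `termMajorant_nonneg`
  (admissible constants on the catalogue), `hsum_termMajorant` (part 1's `hsum` is an IDENTITY for it);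
* §2 **`wellFormed_of_format`** — when the step's entry formats ARE the B13 formats of its own weights (`𝔖.F k = (𝔖.G k).format`, leaf-07's
  default; fork F1 = any other choice stays untouched), route P2's `ReadLip` holds BY CONSTRUCTION for every term of record (leaf-08's
  `TermCore.readLip_toTermDatum` BY NAME) from the one-run `Geometry`, the format equality `G.δ = 𝔡.δ`, ONE format domination `G.v ≤ λR·v` and
  the margin inequalities `rOp ≤ κL, κA, κP, κQ`, `rOp·λR ≤ κR` — inequalities among the instancer's own letters; so `WellFormed` ⟸
  admissible constants + `Geometry` + these letters;
* §3 **`ne5_above_max_record_letters`** — part 2's `ne5_above_max_record_termModel_levels` with `m := termMajorant`: route P2's END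
  `∃ C₅, NE5 (outA 𝔖.toSlots E₀ cB) (outB 𝔖.toSlots E₀ cB) W κ θ′ C₅` displaying, on the analytic side, ONLY: the well-formedness of the term
  family of record (L04∕L05), **ONE (2.38)-shaped inequality `Σ_ℓ G_ℓ(Z) ≤ A_m·e^{−R_m·d(Z)}` on every 𝐃_k** (L03 ∧ L03-dom merged; [II]
  Lemma 3 (2.38) p. 20 KIND, for the summed per-term majorants), L06 at both runs' own input points, the L03∕window numerics, W1∕W4∕W3 of the
  step of record, and the numeric census.  NOT a proof of NE5; cores and constants are NAMED PARAMETERS.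
⚠ CAVEAT (GAPS G-ne5p2-5, kernel-certified in `B13TermDataOpMeasurability`): for every core with a history label over a non-discrete `Ω` the
per-term binder `hgeo` (K6's `Geometry`, field `hopm` over ALL of `ℓ^∞(Species)`) is UNSATISFIABLE, so the END below is vacuous for such cores as
long as the operator slot is `OpDatum (Species …)`; the non-vacuous variant on the MEASURABLE operator slot (`GeometryCore` + measurability side
conditions) is `B13KPStepTermMeasurable.ne5_above_max_record_measOp` (repair R-b).
0 sorry; axioms ⊆ {propext, Classical.choice, Quot.sound}.
-/

noncomputable section

open MeasureTheory
open scoped BigOperators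

namespace Summit.QuantumFields.BalabanUV.T4Continuum.B13KPStepTermLetters

open Literature.MathematicalPhysics.QuantumFieldTheory.Balaban1983to89
open Literature.MathematicalPhysics.QuantumFieldTheory.Balaban1983to89.T4OutputRate (Carriers Functional DecayBound NE5)
open Literature.MathematicalPhysics.QuantumFieldTheory.Balaban1983to89.T4InputCauchyRateData (StepModel)
open Summit.QuantumFields.BalabanUV.T4Continuum.ActivityTermModel (TermDatum TermConsts TermFamily)
open Summit.QuantumFields.BalabanUV.T4Continuum.B13Carriers (TwoRuns)
open Summit.QuantumFields.BalabanUV.T4Continuum.ClusterRepOfDomains (DomainGeometry)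
open Summit.QuantumFields.BalabanUV.T4Continuum.B13DomainGeometryTR (domainGeometry)
open Summit.QuantumFields.BalabanUV.T4Continuum.B13InnerData (b13InnerData Bnd)
open Summit.QuantumFields.BalabanUV.T4Continuum.B13OpDatum (OpDatum Species B13Weights)
open Summit.QuantumFields.BalabanUV.T4Continuum.B13HistDatum (level136)
open Summit.QuantumFields.BalabanUV.T4Continuum.B13HistMeasurable (MeasPotFrame B13HistM)
open Summit.QuantumFields.BalabanUV.T4Continuum.B13StepOfRecord (Slots step outA outB assembly)
open Summit.QuantumFields.BalabanUV.T4Continuum.B13StepTermLabels (InnerLabel innerLabels)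
open Summit.QuantumFields.BalabanUV.T4Continuum.B13KPStepOfRecord (outA_KP outB_KP inputA_KP inputB_KP)
open Summit.QuantumFields.BalabanUV.T4Continuum.B13TermData (TermCore termData)
open Summit.QuantumFields.BalabanUV.T4Continuum.B13StepOfRecordTermData (TermSlots)
open Summit.QuantumFields.BalabanUV.T4Continuum.B13KPStepTermModel (termFamily)
open Summit.QuantumFields.BalabanUV.T4Continuum.B13KPStepTermWindow (ne5_above_max_record_termModel_levels)

variable {𝔾 : Type} [GaugeGroup 𝔾] {R : TwoRuns 𝔾} {P : MeasPotFrame R.carriers} {𝒴 : Type*} {dom : 𝒴 → R.carriers.Dom}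
  {T κ ι S Ω Ω₀ 𝒞 IOp : Type*} [MeasurableSpace Ω] [MeasurableSpace Ω₀] [Fintype ι] [Fintype κ] [DecidableEq ι] [DecidableEq κ]
  (𝔖 : TermSlots R P dom T κ ι S Ω Ω₀ 𝒞 IOp) (𝔡 : R.carriers.Dom → InnerLabel R.carriers.Dom (Bnd R) → TermConsts)

/-! ## §1 The majorant of record -/

/-- [folklore] THE PER-TERM MAJORANT of the term `(Z, ℓ)` of record in units of the moduli: `size + ampOp∕Λop + ampHist∕Λhist` (K6's `G`). -/
def G₀ (Λop Λhist ρ₀ : ℝ) (Z : R.carriers.Dom) (ℓ : InnerLabel R.carriers.Dom (Bnd R)) : ℝ :=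
  (𝔡 Z ℓ).size + (termData 𝔖.F 𝔖.G 𝔖.rHist 𝔖.core Z ℓ).ampOp (𝔡 Z ℓ) ρ₀ / Λop
    + (termData 𝔖.F 𝔖.G 𝔖.rHist 𝔖.core Z ℓ).ampHist (𝔡 Z ℓ) ρ₀ / Λhist

/-- [folklore] **THE MAJORANT OF RECORD**: the sum of the per-term majorants over the inner catalogue of the polymer's own scale,
`m g U Z := Σ_{ℓ ∈ innerLabels (scale Z) Z} G₀ Z ℓ` (independent of the run data; print's resummation (2.26) → (2.38) is such a sum). -/
def termMajorant (Λop Λhist ρ₀ : ℝ) : (ℕ → ℝ) → R.carriers.BgB → R.carriers.Dom → ℝ := fun _ _ Z =>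
  ∑ ℓ ∈ innerLabels (b13InnerData R) (R.carriers.scale Z) Z, G₀ 𝔖 𝔡 Λop Λhist ρ₀ Z ℓ

/-- [folklore] The family's per-term majorant IS `G₀` (`rfl`). -/
theorem G_termFamily_eq (E₀ cB Λop Λhist ρ₀ : ℝ) (g : ℕ → ℝ) (U : R.carriers.BgB) (X Z : R.carriers.Dom)
    (ℓ : InnerLabel R.carriers.Dom (Bnd R)) :
    (termFamily 𝔖 E₀ cB 𝔡).G Λop Λhist ρ₀ g U X Z ℓ = G₀ 𝔖 𝔡 Λop Λhist ρ₀ Z ℓ := rfl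

omit [Fintype ι] [Fintype κ] [DecidableEq ι] [DecidableEq κ] in
/-- [folklore] The per-term majorant is nonnegative for admissible constants and positive moduli. -/
theorem G₀_nonneg {Λop Λhist ρ₀ : ℝ} (hΛop : 0 < Λop) (hΛhist : 0 < Λhist) {Z : R.carriers.Dom}
    {ℓ : InnerLabel R.carriers.Dom (Bnd R)} (hadm : (𝔡 Z ℓ).Admissible) : 0 ≤ G₀ 𝔖 𝔡 Λop Λhist ρ₀ Z ℓ := by
  obtain ⟨hAop, hAh, hsz⟩ := (termData 𝔖.F 𝔖.G 𝔖.rHist 𝔖.core Z ℓ).amp_nonneg (𝔡 Z ℓ) hadm ρ₀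
  unfold G₀
  have := div_nonneg hAop hΛop.le
  have := div_nonneg hAh hΛhist.le
  linarith

omit [Fintype ι] [Fintype κ] [DecidableEq ι] [DecidableEq κ] in
/-- [folklore] The majorant of record is nonnegative (admissible constants on the catalogued labels; every `Z` lies in the catalogue of
its own scale). -/
theorem termMajorant_nonneg {Λop Λhist ρ₀ : ℝ} (hΛop : 0 < Λop) (hΛhist : 0 < Λhist)
    (hadm : ∀ k, ∀ Z ∈ (domainGeometry R).level k, ∀ ℓ ∈ innerLabels (b13InnerData R) k Z, (𝔡 Z ℓ).Admissible)
    (g : ℕ → ℝ) (U : R.carriers.BgB) (Z : R.carriers.Dom) : 0 ≤ termMajorant 𝔖 𝔡 Λop Λhist ρ₀ g U Z :=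
  Finset.sum_nonneg fun ℓ hℓ =>
    G₀_nonneg 𝔖 𝔡 hΛop hΛhist (hadm _ Z ((domainGeometry R).self_mem_level Z) ℓ hℓ)

/-- [folklore] **`hsum` IS AN IDENTITY for the majorant of record** (on the step catalogue of `X`, `scale Z = scale X`). -/
theorem hsum_termMajorant (E₀ cB : ℝ) {Λop Λhist ρ₀ : ℝ} (W : Set (ℕ → ℝ)) :
    ∀ g ∈ W, ∀ (U : R.carriers.BgB) (X : R.carriers.Dom), ∀ Z ∈ (domainGeometry R).level (R.carriers.scale X),
      ∑ ℓ ∈ innerLabels (b13InnerData R) (R.carriers.scale X) Z, (termFamily 𝔖 E₀ cB 𝔡).G Λop Λhist ρ₀ g U X Z ℓ ≤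
        termMajorant 𝔖 𝔡 Λop Λhist ρ₀ g U Z := by
  intro g _ U X Z hZ
  have hsc : R.carriers.scale Z = R.carriers.scale X := ((domainGeometry R).mem_level Z _).1 hZ
  unfold termMajorant
  rw [hsc]
  rfl

/-! ## §2 `ReadLip` by construction in the B13 format of the step's own weights -/

variable [DecidableEq 𝒞]

/-- [folklore] **`WellFormed` FROM THE INSTANCER's LETTERS IN THE B13 FORMAT.**  If the step's entry formats are the B13 formats of its own
weights (`𝔖.F k = (𝔖.G k).format`), then for every catalogued term of record route P2's `ReadLip` at the margins of the term's scale follows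
from leaf-08's `TermCore.readLip_toTermDatum` — inputs: the one-run `Geometry` (displayed anyway), `G.δ = 𝔡.δ`, the `𝐕″`-format domination
`G.v Y ≤ λR·(rHist·‖τ Y‖·level136)` on the core's labels, and the margin inequalities `rOp ≤ κL, κA, κP, κQ`, `rOp·λR ≤ κR`; together with
admissible constants this is `WellFormed` on any window. -/
theorem wellFormed_of_format (E₀ cB : ℝ) (W : Set (ℕ → ℝ)) (hF : ∀ k, 𝔖.F k = (𝔖.G k).format) {lamR : ℝ}
    (hadm : ∀ k, ∀ Z ∈ (domainGeometry R).level k, ∀ ℓ ∈ innerLabels (b13InnerData R) k Z, (𝔡 Z ℓ).Admissible)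
    (hgeo : ∀ k, ∀ Z ∈ (domainGeometry R).level k, ∀ ℓ ∈ innerLabels (b13InnerData R) k Z,
      (termData 𝔖.F 𝔖.G 𝔖.rHist 𝔖.core Z ℓ).Geometry (𝔡 Z ℓ))
    (hδ : ∀ k, ∀ Z ∈ (domainGeometry R).level k, ∀ ℓ ∈ innerLabels (b13InnerData R) k Z, (𝔖.G k).δ = (𝔡 Z ℓ).δ)
    (hvR : ∀ k, ∀ Z ∈ (domainGeometry R).level k, ∀ ℓ ∈ innerLabels (b13InnerData R) k Z, ∀ Y ∈ (𝔖.core Z ℓ).D,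
      (𝔖.G k).v Y ≤ lamR * (𝔖.rHist k * (‖(𝔖.G k).τ Y‖ * level136 P.consts (R.carriers.d (dom Y)))))
    (hκL : ∀ k, ∀ Z ∈ (domainGeometry R).level k, ∀ ℓ ∈ innerLabels (b13InnerData R) k Z, 𝔖.rOp k ≤ (𝔡 Z ℓ).κL)
    (hκA : ∀ k, ∀ Z ∈ (domainGeometry R).level k, ∀ ℓ ∈ innerLabels (b13InnerData R) k Z, 𝔖.rOp k ≤ (𝔡 Z ℓ).κA)
    (hκP : ∀ k, ∀ Z ∈ (domainGeometry R).level k, ∀ ℓ ∈ innerLabels (b13InnerData R) k Z, 𝔖.rOp k ≤ (𝔡 Z ℓ).κP)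
    (hκQ : ∀ k, ∀ Z ∈ (domainGeometry R).level k, ∀ ℓ ∈ innerLabels (b13InnerData R) k Z, 𝔖.rOp k ≤ (𝔡 Z ℓ).κQ)
    (hκR : ∀ k, ∀ Z ∈ (domainGeometry R).level k, ∀ ℓ ∈ innerLabels (b13InnerData R) k Z, 𝔖.rOp k * lamR ≤ (𝔡 Z ℓ).κR) :
    (termFamily 𝔖 E₀ cB 𝔡).WellFormed W := by
  refine B13KPStepTermModel.wellFormed_of_pointwise 𝔖 E₀ cB 𝔡 W hadm hgeo fun k Z hZ ℓ hℓ => ?_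
  have hsc : R.carriers.scale Z = k := ((domainGeometry R).mem_level Z _).1 hZ
  have hg := hgeo k Z hZ ℓ hℓ
  unfold termData at hg ⊢
  rw [hsc, hF k] at hg ⊢
  exact (𝔖.core Z ℓ).readLip_toTermDatum (𝔖.G k) (𝔖.rHist k) (𝔡 Z ℓ) (hδ k Z hZ ℓ hℓ) (hvR k Z hZ ℓ hℓ) hg (𝔖.rOp_pos k)
    (𝔖.rHist_pos k) (hκL k Z hZ ℓ hℓ) (hκA k Z hZ ℓ hℓ) (hκP k Z hZ ℓ hℓ) (hκQ k Z hZ ℓ hℓ) (hκR k Z hZ ℓ hℓ)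

/-! ## §3 The END in the term data's letters -/

/-- [folklore] **ROUTE P2's END ON THE HOLDER's FUNCTIONALS OF RECORD, IN THE TERM DATA's LETTERS** (part 2's
`ne5_above_max_record_termModel_levels` with the majorant of record `m := Σ_ℓ G_ℓ`).  DISPLAYED, analytic side: per catalogued term of
record the admissible constants, the one-run `Geometry` and the read-out structure `ReadLip` (L04∕L05; §2 produces `ReadLip` in the B13
format from the instancer's letters), **ONE (2.38)-shaped
inequality `Σ_{ℓ ∈ innerLabels k Z} G₀ Z ℓ ≤ A_m·e^{−R_m·d(Z)}` on every 𝐃_k** (the summed per-term majorants — sizes and the two amplitudes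
of K6 — decay like [II] Lemma 3 (2.38) p. 20; KIND only, for NAMED-PARAMETER cores), route P2's reference data `RefAt` for every term of
record at BOTH runs' own input points of record (L06); numeric side: `64·log 162 + σ + 64τ ≤ R_m`, `(1+s)·A_m·e^{5σ+64τ}·K₀(64,8)·9 ≤ τ`,
`κ + 1 ≤ σ`, `64·log 162 + 64 ≤ R_m`, `36·A_m·e^{64}·K₀(64,8) < 1`, (R1)–(R3), the rate clause; other rows: W1 `OperatorRate`, W4
`InsertionRate` (level `64τe^{−5σ}`), W3 `InsScaleBound` of the step of record; the holder's transport reading.  DISCHARGED: MI-R, L07,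
L08a∕b, L03-geometry, L03-dom, L09 ×2, the insertion structure, R-IDENT's window binders.  NOT a proof of NE5.  ⚠ G-ne5p2-5: `hgeo` is
unsatisfiable for cores with a history label over non-discrete `Ω` (see the header); non-vacuous variant: `B13KPStepTermMeasurable`. -/
theorem ne5_above_max_record_letters (E₀ cB : ℝ) (hT : (assembly 𝔖.toSlots).TransportReads Set.univ) {W : Set (ℕ → ℝ)}
    {A_m R_m τ σ s E₁ κ θ δ δ' c ω Λop Λhist ρ₀ ρ₀' : ℝ}
    -- numerics of L03 and of the window
    (hA_m : 0 ≤ A_m) (hτ : 0 ≤ τ) (hσ : 0 ≤ σ) (hs0 : 0 ≤ s)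
    (hrate : 64 * Real.log 162 + σ + τ * 64 ≤ R_m)
    (hsmall : (1 + s) * A_m * Real.exp (σ * 5 + τ * 64) * B12TreeDecay.K₀ (4 * 2 ^ 4) (2 * 4) * 9 ≤ τ) (hσκ : κ + 1 ≤ σ)
    (hrate' : 64 * Real.log 162 + 64 ≤ R_m) (hsmall' : 36 * (A_m * Real.exp 64 * B12TreeDecay.K₀ (4 * 2 ^ 4) (2 * 4)) < 1)
    -- L04∕L05 per term of record: admissible constants, one-run geometry, read-out Lipschitz structure at the margins of the term's scale
    (hadm : ∀ k, ∀ Z ∈ (domainGeometry R).level k, ∀ ℓ ∈ innerLabels (b13InnerData R) k Z, (𝔡 Z ℓ).Admissible)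
    (hgeo : ∀ k, ∀ Z ∈ (domainGeometry R).level k, ∀ ℓ ∈ innerLabels (b13InnerData R) k Z,
      (termData 𝔖.F 𝔖.G 𝔖.rHist 𝔖.core Z ℓ).Geometry (𝔡 Z ℓ))
    (hlip : ∀ k, ∀ Z ∈ (domainGeometry R).level k, ∀ ℓ ∈ innerLabels (b13InnerData R) k Z,
      (termData 𝔖.F 𝔖.G 𝔖.rHist 𝔖.core Z ℓ).ReadLip (𝔡 Z ℓ) (𝔖.rOp (R.carriers.scale Z)) (𝔖.rHist (R.carriers.scale Z)))
    -- L03: ONE (2.38)-shaped inequality on the summed per-term majorants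
    (h238 : ∀ k, ∀ Z ∈ (domainGeometry R).level k,
      ∑ ℓ ∈ innerLabels (b13InnerData R) k Z, G₀ 𝔖 𝔡 Λop Λhist ρ₀ Z ℓ ≤ A_m * Real.exp (-(R_m * R.carriers.d Z)))
    (hρ₁ : ρ₀ ≤ 1)
    -- L06 at BOTH runs' own input points of record
    (hRef : ∀ g ∈ W, ∀ (U : R.carriers.BgB) (X : R.carriers.Dom),
      ∀ Z ∈ (domainGeometry R).level (R.carriers.scale X), ∀ ℓ ∈ innerLabels (b13InnerData R) (R.carriers.scale X) Z,
        (termData 𝔖.F 𝔖.G 𝔖.rHist 𝔖.core Z ℓ).RefAt (𝔡 Z ℓ) (inputB_KP 𝔖.toSlots E₀ cB g U X))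
    (hRefA : ∀ g ∈ W, ∀ (U : R.carriers.BgB) (X : R.carriers.Dom),
      ∀ Z ∈ (domainGeometry R).level (R.carriers.scale X), ∀ ℓ ∈ innerLabels (b13InnerData R) (R.carriers.scale X) Z,
        (termData 𝔖.F 𝔖.G 𝔖.rHist 𝔖.core Z ℓ).RefAt (𝔡 Z ℓ) (inputA_KP 𝔖.toSlots E₀ cB g U X))
    -- W1, W4, W3 in the holder's currency
    (hop : (step 𝔖.toSlots E₀ cB).OperatorRate W δ θ)
    (hins : (step 𝔖.toSlots E₀ cB).InsertionRate W κ (τ * 64 * Real.exp (-(σ * 5))) δ' θ)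
    (hunit : (step 𝔖.toSlots E₀ cB).InsScaleBound W κ E₁ c ω)
    -- numerics
    (hE₁ : 0 < E₁) (hΛop : 0 < Λop) (hΛhist : 0 < Λhist) (hρ : max (Λhist / Λop) 1 * ρ₀' ≤ ρ₀)
    (hs : Λhist * ρ₀' < s) (hδ : 0 ≤ δ) (hδ' : 0 ≤ δ') (hθ : 0 ≤ θ) (hθ1 : θ < 1)
    (hc : 0 ≤ c) (hω : 0 < ω) (hω1 : ω < 1)
    (hreach : c * (τ * 64 * Real.exp (-(σ * 5)) + τ * 64 * Real.exp (-(σ * 5))) / (1 - ω) < ρ₀')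
    {θ' : ℝ} (hθ' : max θ (ω + (τ * 64 * Real.exp (-(σ * 5))) * Λhist / (s - Λhist * ρ₀') * c) < θ') :
    ∃ C₅, NE5 (outA 𝔖.toSlots E₀ cB) (outB 𝔖.toSlots E₀ cB) W κ θ' C₅ := by
  have hwf : (termFamily 𝔖 E₀ cB 𝔡).WellFormed W := B13KPStepTermModel.wellFormed_of_pointwise 𝔖 E₀ cB 𝔡 W hadm hgeo hlip
  have hm : ∀ g ∈ W, ∀ (U : R.carriers.BgB) (k : ℕ), ∀ Z ∈ R.domAt k,
      termMajorant 𝔖 𝔡 Λop Λhist ρ₀ g U Z ≤ A_m * Real.exp (-(R_m * R.carriers.d Z)) := by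
    intro g _ U k Z hZ
    have hsc : R.carriers.scale Z = k := ((domainGeometry R).mem_level Z _).1 hZ
    have h := h238 k Z hZ
    unfold termMajorant
    rw [hsc]
    exact h
  exact ne5_above_max_record_termModel_levels 𝔖 E₀ cB 𝔡 hT hA_m hτ hσ hs0 (termMajorant_nonneg 𝔖 𝔡 hΛop hΛhist hadm) hm hrate
    hsmall hσκ hrate' hsmall' hwf (hsum_termMajorant 𝔖 𝔡 E₀ cB W) hρ₁ hRef hRefA hop hins hunit hE₁ hΛop hΛhist hρ hs hδ hδ' hθ hθ1 hc
    hω hω1 hreach hθ'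

end Summit.QuantumFields.BalabanUV.T4Continuum.B13KPStepTermLetters

end
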